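import Summits.AtomisticToContinuum.HydrodynamicLimit.Theorems.CollisionIsometryCLTDiffuseBackwardInfluencePairDominate
import HarnessLib

/-!
# `DiffuseBackwardInfluence`, line `share-nondegeneracy-one-flight`, stub `stub_pairPathBoundT` (lead c6), 2/3: the CHARGE ACCOUNTING —
the resolution charges of the window (`chargeAt`) are sums of LEVIES on (slot, particle) pairs, each pair is levied at most once over the
window (or at the end, for the final pending slots) and by at most its idle/degenerate BUDGET (whose source sum is `(N+1)·Σ_r (idleFr_r + degFr_r)`
by `sum_charge_le`) (skeleton v8; crux stmt-AtomisticToContinuum-12950, `--supports`).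
-/

namespace Summit.AtomisticToContinuum.HydrodynamicLimit.Theorems.DiffuseBackwardInfluenceShare

open scoped BigOperators Topology ENNReal InnerProductSpace Classical
open Filter Set MeasureTheory
open Literature.Analysis.FluidPDE (Config HardSphereFlow collidePair)
open Literature.MathematicalPhysics.KineticTheory (localGibbsLaw hsDiameter)
open Summit.AtomisticToContinuum.HydrodynamicLimit.Theorems.DiffuseBackwardInfluenceNeg

noncomputable section

namespace PairPath

section Charge

variable {N : ℕ} {C : OnePath.Src N}

/-! ### §A Gap slots -/

variable (C) in
/-- Slot `r` is a GAP SLOT of particle `i` at step `n`: it has started and `i` has not been touched since its start. -/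
def GapSlot (n r : ℕ) (i : Fin (N + 1)) : Prop :=
  r < S C ∧ OnePath.nS C r ≤ n ∧ ∀ c, OnePath.nS C r ≤ c → c < n → ¬ Touches C.σ N C.y c i

/-- The gap is the number of gap slots (definitional). [folklore] -/
theorem gap_eq_card (n : ℕ) (i : Fin (N + 1)) :
    gap C n i = ((Finset.range (S C)).filter fun r => GapSlot C n r i).card := by
  unfold gap GapSlot
  congr 1
  ext r
  simp only [Finset.mem_filter, Finset.mem_range]
  tauto

/-- A started slot index is below the started-slot counter. [folklore] -/
private theorem lt_cnt_of_started (hΔ : 0 < C.Δ) (hpos : 0 < OnePath.fin C) {r n : ℕ} (hr : r < S C)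
    (hn : OnePath.nS C r ≤ n) : r < cnt C n := by
  have hS : 0 < 2 * C.m * C.L := lt_of_le_of_lt (Nat.zero_le r) hr
  have hsub : Finset.range (r + 1) ⊆ (Finset.range (S C)).filter fun r' => OnePath.nS C r' ≤ n := by
    intro r' hr'
    rw [Finset.mem_range] at hr'
    rw [Finset.mem_filter, Finset.mem_range]
    exact ⟨lt_of_le_of_lt (Nat.lt_succ_iff.1 hr') hr,
      le_trans (OnePath.slotStart_mono hΔ hpos hS (Nat.lt_succ_iff.1 hr') hr.le) hn⟩
  have := Finset.card_le_card hsub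
  rw [Finset.card_range] at this
  exact this

/-- Conversely, a slot index below the counter has started. [folklore] -/
private theorem nS_le_of_lt_cnt (hΔ : 0 < C.Δ) (hpos : 0 < OnePath.fin C) {r n : ℕ} (h : r < cnt C n) :
    OnePath.nS C r ≤ n := by
  by_contra hlt
  push Not at hlt
  have hsub : (Finset.range (S C)).filter (fun r' => OnePath.nS C r' ≤ n) ⊆ Finset.range r := by
    intro r' hr'
    rw [Finset.mem_filter, Finset.mem_range] at hr'
    rw [Finset.mem_range]
    by_contra hge
    push Not at hge
    have hS : 0 < 2 * C.m * C.L := lt_of_le_of_lt (Nat.zero_le r') hr'.1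
    have := OnePath.slotStart_mono hΔ hpos hS hge hr'.1.le
    unfold OnePath.nS at hlt this hr'
    omega
  have hle := Finset.card_le_card hsub
  rw [Finset.card_range] at hle
  exact absurd (lt_of_lt_of_le h hle) (lt_irrefl r)

/-- Gap slots form a final segment of the started slots: a gap slot is `≥ cnt − gap`, and conversely every started `r ≥ cnt − gap` with
`r` at least a gap slot is one; here only the easy half is needed: `cnt n − gap n i ≤ r` for a gap slot `r`. [folklore] -/
theorem cnt_sub_gap_le_of_gapSlot (hΔ : 0 < C.Δ) (hpos : 0 < OnePath.fin C) {n r : ℕ} {i : Fin (N + 1)}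
    (h : GapSlot C n r i) : cnt C n - gap C n i ≤ r := by
  have hS : 0 < 2 * C.m * C.L := lt_of_le_of_lt (Nat.zero_le r) h.1
  -- every started slot r' ≥ r is a gap slot
  have hsub : ((Finset.range (S C)).filter fun r' => OnePath.nS C r' ≤ n).filter (fun r' => r ≤ r') ⊆
      (Finset.range (S C)).filter fun r' => GapSlot C n r' i := by
    intro r' hr'
    simp only [Finset.mem_filter, Finset.mem_range] at hr' ⊢
    refine ⟨hr'.1.1, hr'.1.1, hr'.1.2, fun c hc1 hc2 => h.2.2 c (le_trans ?_ hc1) hc2⟩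
    exact OnePath.slotStart_mono hΔ hpos hS hr'.2 hr'.1.1.le
  have hcard := Finset.card_le_card hsub
  rw [← gap_eq_card] at hcard
  -- the started slots below r are at most r of them
  have hsplit := Finset.card_filter_add_card_filter_not
    (s := (Finset.range (S C)).filter fun r' => OnePath.nS C r' ≤ n) (fun r' => r ≤ r')
  have hlow : (((Finset.range (S C)).filter fun r' => OnePath.nS C r' ≤ n).filter (fun r' => ¬ r ≤ r')).card ≤ r := by
    calc _ ≤ (Finset.range r).card := Finset.card_le_card fun r' hr' => by
            simp only [Finset.mem_filter, Finset.mem_range, not_le] at hr' ⊢; exact hr'.2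
      _ = r := Finset.card_range r
  unfold cnt
  omega

/-! ### §B The budget and the levies -/

variable (C) in
/-- The BUDGET of `(r, i)`: the tracer mass of `i` at the slot start if `i` is idle on slot `r`, plus its tracer mass at its first collision
of slot `r` if that collision is `η`-degenerate for the block `(i, source)` (the summand of `sum_charge_le`). -/
def budget (r : ℕ) (i : Fin (N + 1)) : ℝ :=
  (if IdleOn C.σ N C.y C.Δ (S C) r i then OnePath.mu C (OnePath.nS C r) i else 0) +
    (if HasCollIn C.σ N C.y C.Δ (S C) r i ∧ i ∉ OnePath.Good C r then OnePath.mu C (OnePath.cfirst C r i) i else 0)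

/-- The budget is nonnegative. [folklore] -/
theorem budget_nonneg (r : ℕ) (i : Fin (N + 1)) : 0 ≤ budget C r i := by
  unfold budget
  refine add_nonneg ?_ ?_ <;> split_ifs <;> first | exact OnePath.mu_nonneg _ _ | exact le_rfl

variable (C) in
/-- The LEVY of step `c` on `(r, i)` (box `K + 2`): the together mass of `i` if `c` reflects a pair containing `i`, `r` is a gap slot of
`i` at `c`, and the slot is CHARGED (not the current slot, or the current slot without an effective score). -/
def levy (K c r : ℕ) (i : Fin (N + 1)) : ℝ :=
  if h : (pairsAt C.σ N C.y c).Nonempty then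
    (if (i = h.some.1 ∨ i = h.some.2) ∧ GapSlot C c r i ∧ (r + 1 < cnt C c ∨ dltR C c h.some.1 h.some.2 i = 0) then
      sT (K + 2) (Tm C c) i else 0)
  else 0

variable (C) in
/-- The FINAL LEVY on `(r, i)`: the together mass of `i` at the end if `r` is still a gap slot of `i` then. -/
def finalLevy (K r : ℕ) (i : Fin (N + 1)) : ℝ :=
  if GapSlot C (OnePath.fin C) r i then sT (K + 2) (Tm C (OnePath.fin C)) i else 0

/-- `sT` of the together profile is `μ²`, hence in `[0, μ]`. [folklore] -/
theorem sT_Tm_le_mu {K n : ℕ} (hn : n ≤ K) (i : Fin (N + 1)) :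
    0 ≤ sT (K + 2) (Tm C n) i ∧ sT (K + 2) (Tm C n) i ≤ OnePath.mu C n i := by
  rw [(marginal (C := C) K n hn).1 i]
  refine ⟨sq_nonneg _, ?_⟩
  have h0 := OnePath.mu_nonneg (C := C) n i
  have h1 := OnePath.mu_le_one (C := C) n i
  nlinarith

/-! ### §C The charge of a step is the sum of its levies -/

/-- Counting the charged gap slots of a host: `gap − (effective score)`. [folklore] -/
theorem card_charged (hΔ : 0 < C.Δ) (hpos : 0 < OnePath.fin C) {c : ℕ} (h : (pairsAt C.σ N C.y c).Nonempty)
    (i : Fin (N + 1)) :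
    (((Finset.range (S C)).filter fun r => GapSlot C c r i ∧ (r + 1 < cnt C c ∨ dltR C c h.some.1 h.some.2 i = 0)).card : ℝ) =
      (gap C c i : ℝ) - (dltR C c h.some.1 h.some.2 i : ℝ) := by
  by_cases hd : dltR C c h.some.1 h.some.2 i = 0
  · rw [hd, Nat.cast_zero, sub_zero, gap_eq_card]
    congr 2
    exact Finset.filter_congr fun r _ => by simp
  · have hd1 : dltR C c h.some.1 h.some.2 i = 1 := by have := dltR_le_one (C := C) c h.some.1 h.some.2 i; omega
    have hdlt : dlt C c i = 1 := by have := dltR_le_dlt (C := C) c h.some.1 h.some.2 i; have := dlt_le_one (C := C) c i; omega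
    have hgap : 1 ≤ gap C c i := by
      unfold dlt at hdlt
      split_ifs at hdlt with hh
      · exact hh.1
    -- the current slot cnt c − 1 is a gap slot, and it is the only uncharged one
    have hcur : GapSlot C c (cnt C c - 1) i := by
      have hcnt : 1 ≤ cnt C c := le_trans hgap (gap_le_cnt c i)
      rw [gap_eq_card] at hgap
      obtain ⟨r₀, hr₀⟩ := Finset.card_pos.1 (lt_of_lt_of_le Nat.zero_lt_one hgap)
      rw [Finset.mem_filter, Finset.mem_range] at hr₀
      have hS : 0 < 2 * C.m * C.L := lt_of_le_of_lt (Nat.zero_le r₀) hr₀.1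
      have hle : r₀ ≤ cnt C c - 1 := by
        have := lt_cnt_of_started hΔ hpos hr₀.1 hr₀.2.2.1
        omega
      have hltS : cnt C c - 1 < S C := by have := cnt_le (C := C) c; omega
      have hstarted : OnePath.nS C (cnt C c - 1) ≤ c := nS_le_of_lt_cnt hΔ hpos (by omega)
      exact ⟨hltS, hstarted, fun c' hc1 hc2 => hr₀.2.2.2 c' (le_trans
        (OnePath.slotStart_mono hΔ hpos hS hle hltS.le) hc1) hc2⟩
    have heq : ((Finset.range (S C)).filter fun r => GapSlot C c r i ∧ (r + 1 < cnt C c ∨ dltR C c h.some.1 h.some.2 i = 0)) =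
        ((Finset.range (S C)).filter fun r => GapSlot C c r i).erase (cnt C c - 1) := by
      ext r
      simp only [Finset.mem_filter, Finset.mem_range, Finset.mem_erase, hd1]
      constructor
      · rintro ⟨hr, hg, hor⟩
        rcases hor with hlt | h10
        · exact ⟨by omega, hr, hg⟩
        · exact absurd h10 one_ne_zero
      · rintro ⟨hne, hr, hg⟩
        refine ⟨hr, hg, Or.inl ?_⟩
        have : r < cnt C c := lt_cnt_of_started hΔ hpos hr hg.2.1
        omega
    rw [heq, Finset.card_erase_of_mem, gap_eq_card, hd1, Nat.cast_sub, Nat.cast_one]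
    · exact Finset.card_pos.2 ⟨_, Finset.mem_filter.2 ⟨Finset.mem_range.2 hcur.1, hcur⟩⟩
    · exact Finset.mem_filter.2 ⟨Finset.mem_range.2 hcur.1, hcur⟩

/-- THE CHARGE OF A STEP IS THE SUM OF ITS LEVIES. [folklore] -/
theorem chargeAt_eq_sum_levy (hΔ : 0 < C.Δ) (hpos : 0 < OnePath.fin C) (K c : ℕ) :
    chargeAt C K c = ∑ i, ∑ r ∈ Finset.range (S C), levy C K c r i := by
  unfold chargeAt levy
  by_cases h : (pairsAt C.σ N C.y c).Nonempty
  · simp only [dif_pos h]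
    have hpq := some_fst_ne_some_snd h
    -- per particle: the levies of i sum to (gap − dltR) · sT if i is a host, else 0
    have hi : ∀ i, ∑ r ∈ Finset.range (S C),
        (if (i = h.some.1 ∨ i = h.some.2) ∧ GapSlot C c r i ∧ (r + 1 < cnt C c ∨ dltR C c h.some.1 h.some.2 i = 0) then
          sT (K + 2) (Tm C c) i else 0) =
        if i = h.some.1 ∨ i = h.some.2 then
          ((gap C c i : ℝ) - (dltR C c h.some.1 h.some.2 i : ℝ)) * sT (K + 2) (Tm C c) i else 0 := by
      intro i
      by_cases hh : i = h.some.1 ∨ i = h.some.2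
      · rw [if_pos hh, ← card_charged hΔ hpos h i, ← Finset.sum_filter]
        simp only [hh, true_and]
        rw [Finset.sum_const, nsmul_eq_mul]
      · rw [if_neg hh]
        exact Finset.sum_eq_zero fun r _ => if_neg fun hc => hh hc.1
    rw [Finset.sum_congr rfl fun i _ => hi i]
    rw [Finset.sum_ite, Finset.sum_const_zero, add_zero]
    have hfilter : (Finset.univ.filter fun i : Fin (N + 1) => i = h.some.1 ∨ i = h.some.2) = {h.some.1, h.some.2} := by
      ext i; simp
    rw [hfilter, Finset.sum_pair hpq]
  · simp only [dif_neg h]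
    simp

/-! ### §D Each (slot, particle) is levied at most once, and by at most its budget -/

/-- A levy is nonnegative and at most the budget. [folklore] -/
theorem levy_le_budget (hΔ : 0 < C.Δ) (hpos : 0 < OnePath.fin C) (hm : 1 ≤ C.m) (hL : 1 ≤ C.L) {K c : ℕ} (hcK : c ≤ K)
    (hc : c < OnePath.fin C) (r : ℕ) (i : Fin (N + 1)) : 0 ≤ levy C K c r i ∧ levy C K c r i ≤ budget C r i := by
  have hb := budget_nonneg (C := C) r i
  unfold levy
  by_cases h : (pairsAt C.σ N C.y c).Nonempty
  · rw [dif_pos h]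
    split_ifs with hh
    · obtain ⟨hhost, hg, hor⟩ := hh
      obtain ⟨h0, h1⟩ := sT_Tm_le_mu (C := C) hcK i
      refine ⟨h0, ?_⟩
      have hmu : OnePath.mu C c i = OnePath.mu C (OnePath.nS C r) i :=
        mu_eq_of_not_touches hg.2.1 hg.2.2
      unfold budget
      have hlt_cnt : r < cnt C c := lt_cnt_of_started hΔ hpos hg.1 hg.2.1
      have hdeg0 : 0 ≤ (if HasCollIn C.σ N C.y C.Δ (S C) r i ∧ i ∉ OnePath.Good C r then
          OnePath.mu C (OnePath.cfirst C r i) i else 0) := by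
        split_ifs
        · exact OnePath.mu_nonneg _ _
        · exact le_rfl
      have hidle0 : 0 ≤ (if IdleOn C.σ N C.y C.Δ (S C) r i then OnePath.mu C (OnePath.nS C r) i else 0) := by
        split_ifs
        · exact OnePath.mu_nonneg _ _
        · exact le_rfl
      by_cases hlt : r + 1 < cnt C c
      · -- an earlier gap slot: idle on it
        have hidle : IdleOn C.σ N C.y C.Δ (S C) r i :=
          idleOn_of_gap hΔ hpos hm hL (cnt_sub_gap_le_of_gapSlot hΔ hpos hg) hlt
        rw [if_pos hidle, ← hmu]
        linarith
      · -- the current slot, without an effective score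
        have hd0 : dltR C c h.some.1 h.some.2 i = 0 := hor.resolve_left hlt
        have hrc : r = cnt C c - 1 := by omega
        by_cases hmu0 : OnePath.mu C c i = 0
        · have : sT (K + 2) (Tm C c) i = 0 := le_antisymm (hmu0 ▸ h1) h0
          rw [this]; linarith
        · have htouch : Touches C.σ N C.y c i := (touches_iff_of h i).2 hhost
          have hgap1 : 1 ≤ gap C c i := by
            rw [gap_eq_card]
            exact Finset.card_pos.2 ⟨r, Finset.mem_filter.2 ⟨Finset.mem_range.2 hg.1, hg⟩⟩
          obtain ⟨hcoll, hcf⟩ := cfirst_of_gap_pos hΔ hpos hm hL hc htouch hgap1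
          -- dltR = 0 with a massive host means dlt = 0, i.e. the first collision is degenerate
          have hdlt : dlt C c i = 0 := by
            by_contra hne
            have h1' : dlt C c i = 1 := by have := dlt_le_one (C := C) c i; omega
            unfold dltR at hd0
            rw [if_pos ⟨hhost, h1', hmu0⟩] at hd0
            exact one_ne_zero hd0
          have hnotgood : i ∉ OnePath.Good C (cnt C c - 1) := by
            intro hgood
            unfold dlt at hdlt
            rw [if_pos ⟨hgap1, hgood⟩] at hdlt
            exact one_ne_zero hdlt
          subst hrc
          rw [if_pos (show HasCollIn C.σ N C.y C.Δ (S C) (cnt C c - 1) i ∧ i ∉ OnePath.Good C (cnt C c - 1) from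
            ⟨hcoll, hnotgood⟩), hcf]
          linarith
    · exact ⟨le_rfl, hb⟩
  · rw [dif_neg h]; exact ⟨le_rfl, hb⟩

end Charge

section BoundA

variable {N : ℕ} {C : OnePath.Src N}

/-! ### §G The per-source bound -/

/-- At most one of a family of nonnegative reals is nonzero, and each is below `β`: the sum is below `β`. [folklore] -/
theorem sum_le_of_atMostOne {α : Type*} (s : Finset α) (x : α → ℝ) (β : ℝ) (hβ : 0 ≤ β) (_h0 : ∀ a ∈ s, 0 ≤ x a)
    (hle : ∀ a ∈ s, x a ≤ β) (h1 : ∀ a ∈ s, ∀ b ∈ s, x a ≠ 0 → x b ≠ 0 → a = b) : ∑ a ∈ s, x a ≤ β := by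
  by_cases hex : ∃ a ∈ s, x a ≠ 0
  · obtain ⟨a, ha, hxa⟩ := hex
    rw [Finset.sum_eq_single_of_mem a ha (fun b hb hba => by_contra fun hxb => hba (h1 b hb a ha hxb hxa))]
    exact hle a ha
  · push Not at hex
    rw [Finset.sum_eq_zero hex]
    exact hβ

/-- THE LEVIES OF ONE (slot, particle) OVER THE WINDOW, plus the final levy, are at most its budget (each is levied at most once). [folklore] -/
theorem sum_levy_le_budget (hΔ : 0 < C.Δ) (hpos : 0 < OnePath.fin C) (hm : 1 ≤ C.m) (hL : 1 ≤ C.L) {K : ℕ}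
    (hK : OnePath.fin C ≤ K) (r : ℕ) (i : Fin (N + 1)) :
    ∑ c ∈ Finset.range (OnePath.fin C), levy C K c r i + finalLevy C K r i ≤ budget C r i := by
  -- put the final levy as the term `c = fin`
  have hkey : ∑ c ∈ Finset.range (OnePath.fin C + 1),
      (if c = OnePath.fin C then finalLevy C K r i else levy C K c r i) ≤ budget C r i := by
    refine sum_le_of_atMostOne _ _ _ (budget_nonneg r i) ?_ ?_ ?_
    · intro c hc
      split_ifs with hcf
      · unfold finalLevy; split_ifs
        · exact (sT_Tm_le_mu (C := C) hK i).1
        · exact le_rfl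
      · exact (levy_le_budget hΔ hpos hm hL (by have := Finset.mem_range.1 hc; omega)
          (by have := Finset.mem_range.1 hc; omega) r i).1
    · intro c hc
      split_ifs with hcf
      · unfold finalLevy; split_ifs with hg
        · obtain ⟨h0, h1⟩ := sT_Tm_le_mu (C := C) hK i
          unfold budget
          have hidle : IdleOn C.σ N C.y C.Δ (S C) r i := by
            have := cnt_fin hΔ hpos hm hL (C := C)
            refine idleOn_of_gap_fin hΔ hpos hm hL ?_ hg.1
            have := cnt_sub_gap_le_of_gapSlot hΔ hpos hg
            omega
          rw [if_pos hidle, ← mu_eq_of_not_touches hg.2.1 hg.2.2]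
          have : 0 ≤ (if HasCollIn C.σ N C.y C.Δ (S C) r i ∧ i ∉ OnePath.Good C r then
              OnePath.mu C (OnePath.cfirst C r i) i else 0) := by
            split_ifs
            · exact OnePath.mu_nonneg _ _
            · exact le_rfl
          linarith
        · exact budget_nonneg r i
      · exact (levy_le_budget hΔ hpos hm hL (by have := Finset.mem_range.1 hc; omega)
          (by have := Finset.mem_range.1 hc; omega) r i).2
    · -- at most one nonzero: a nonzero levy at c means c touches i and r is a gap slot at c
      have hlev : ∀ c, levy C K c r i ≠ 0 → Touches C.σ N C.y c i ∧ GapSlot C c r i := by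
        intro c hc
        unfold levy at hc
        by_cases h : (pairsAt C.σ N C.y c).Nonempty
        · rw [dif_pos h] at hc
          split_ifs at hc with hh
          · exact ⟨(touches_iff_of h i).2 hh.1, hh.2.1⟩
          · exact absurd rfl hc
        · rw [dif_neg h] at hc; exact absurd rfl hc
      have hfin : finalLevy C K r i ≠ 0 → GapSlot C (OnePath.fin C) r i := by
        intro hc; unfold finalLevy at hc; split_ifs at hc with hg
        · exact hg
        · exact absurd rfl hc
      -- two gap-slot witnesses at different steps contradict each other
      have hexcl : ∀ c c', c < c' → Touches C.σ N C.y c i → GapSlot C c r i → GapSlot C c' r i → False :=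
        fun c c' hcc ht hg hg' => hg'.2.2 c hg.2.1 hcc ht
      intro a ha b hb hxa hxb
      rw [Finset.mem_range] at ha hb
      by_contra hab
      split_ifs at hxa hxb with ha' hb' hb'
      · exact hab (ha'.trans hb'.symm)
      · obtain ⟨ht, hg⟩ := hlev b hxb
        exact hexcl b a (by omega) ht hg (ha' ▸ hfin hxa)
      · obtain ⟨ht, hg⟩ := hlev a hxa
        exact hexcl a b (by omega) ht hg (hb' ▸ hfin hxb)
      · obtain ⟨hta, hga⟩ := hlev a hxa
        obtain ⟨htb, hgb⟩ := hlev b hxb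
        rcases lt_or_gt_of_ne hab with hlt | hlt
        · exact hexcl a b hlt hta hga hgb
        · exact hexcl b a hlt htb hgb hga
  rw [Finset.sum_range_succ, if_pos rfl] at hkey
  rw [Finset.sum_congr rfl fun c hc => (if_neg (Finset.mem_range.1 hc).ne).symm]
  exact hkey

/-- The final levies of a particle count its final gap: `gap(fin, i) · sT = Σ_r finalLevy r i`. [folklore] -/
theorem sum_finalLevy (K : ℕ) (i : Fin (N + 1)) :
    ∑ r ∈ Finset.range (S C), finalLevy C K r i = (gap C (OnePath.fin C) i : ℝ) * sT (K + 2) (Tm C (OnePath.fin C)) i := by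
  unfold finalLevy
  rw [Finset.sum_ite, Finset.sum_const_zero, add_zero, Finset.sum_const, nsmul_eq_mul, gap_eq_card]

/-- THE CHARGES OF THE WINDOW PLUS THE FINAL PENDING SLOTS ARE PAID BY THE BUDGET of the source. [folklore] -/
theorem charges_le_budget (hΔ : 0 < C.Δ) (hpos : 0 < OnePath.fin C) (hm : 1 ≤ C.m) (hL : 1 ≤ C.L) {K : ℕ}
    (hK : OnePath.fin C ≤ K) :
    ∑ c ∈ Finset.range (OnePath.fin C), chargeAt C K c +
        ∑ i, (gap C (OnePath.fin C) i : ℝ) * sT (K + 2) (Tm C (OnePath.fin C)) i ≤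
      ∑ r ∈ Finset.range (S C), ∑ i, budget C r i := by
  rw [Finset.sum_congr rfl fun c _ => chargeAt_eq_sum_levy hΔ hpos K c]
  rw [Finset.sum_comm, ← Finset.sum_congr rfl fun i _ => sum_finalLevy (C := C) K i, ← Finset.sum_add_distrib]
  rw [Finset.sum_comm (s := Finset.range (S C))]
  refine Finset.sum_le_sum fun i _ => ?_
  rw [Finset.sum_comm, ← Finset.sum_add_distrib]
  exact Finset.sum_le_sum fun r _ => sum_levy_le_budget hΔ hpos hm hL hK r i

end BoundA


/-- REGISTERED HEADLINE (sub-goal `pairPath_charges_le_budget`): charges + final pending slots ≤ budget. [folklore] -/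
theorem pairPath_charges_le_budget : ∀ (N : ℕ) (C : OnePath.Src N), 0 < C.Δ → 0 < OnePath.fin C → 1 ≤ C.m → 1 ≤ C.L → ∀ (K : ℕ), OnePath.fin C ≤ K → ∑ c ∈ Finset.range (OnePath.fin C), PairPath.chargeAt C K c + ∑ i, (PairPath.gap C (OnePath.fin C) i : ℝ) * PairPath.sT (K + 2) (PairPath.Tm C (OnePath.fin C)) i ≤ ∑ r ∈ Finset.range (PairPath.S C), ∑ i, PairPath.budget C r i :=
  fun _ _ hΔ hpos hm hL _ hK => charges_le_budget hΔ hpos hm hL hK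

end PairPath

end

end Summit.AtomisticToContinuum.HydrodynamicLimit.Theorems.DiffuseBackwardInfluenceShare
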